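/-
COR-CM (cell pub-hodgecm2, stage 2 of the Hodge ladder) — count-neutral KERNEL COMBINATORICS «the order-16 dispatch», part IV: THE LAW — EVERY GROUP OF
ORDER 16 AND EVERY CENTRAL INVOLUTION: `μ(G, c) = φ₂(G, c)`, classification-free (seat prover-pub-hodgecm2-b23-g55-0, binder prover b23, gen 55; claim
HOME/INBOX.md l.25631).  Theorems only; the laws of seat b23 gen 50 (2-groups with a cyclic subgroup of index two), seat b09 gen 44 (the commutator law),
seat b23 gen 54 (quaternion pair, dihedral quotient data = seat b09 gen 46ʼs kernel-two law) BY NAME; no `decide`, no certificate, no named fact, no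
`sorry`.  `Interfaces.lean` (C1), every E term, B01, `Transposition/*`, `PortJoin/*`, `D2Bridge/*` untouched.
HONEST FRAMING: `HC_CM` is NOT proved, here or anywhere in the tree; nothing here is a period, a count of record or a headline.
T5: n/a-class (hypothesis binders `|G| = 16`, `c` a central involution `≠ 1` — inhabited by each of the fourteen groups of order `16`); checker: self.
-/
import Summits.HodgeConjecture.CorCM.Census.OrderSixteenBricks
import Summits.HodgeConjecture.CorCM.Census.CyclicCharacterCommutatorLaw
import Summits.HodgeConjecture.CorCM.Census.IndexTwoCyclicOrderEight

/-!
# The order-16 dispatch, IV: every group of order `16`, every central involution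

**`isLeast_card_gfaces_generate_fibreTwo_of_card_eq_sixteen`**: `|G| = 16`, `c` a central involution `≠ 1` ⟹ **`μ(G, c) = φ₂(G, c)`** — the least
number of G-faces whose translates together with the pairs generate the Hodge span is the coinvariant floor, with NO hypothesis on the group.
The dispatch (classification-free):
* (A) an element of order `8` ⟹ seat b23 gen 50ʼs `IndexTwoCyclic.isLeast_card_gfaces_generate_fibreTwo_of_two_group`;
* (K) `c ∉ [G, G]` ⟹ seat b09 gen 44ʼs `CyclicCharacter.isLeast_card_gfaces_generate_fibreTwo_of_notMem_commutator`;
* (R) `c ∈ [G, G]`, exponent `4` (`isLeast_of_mem_commutator`, §2): by parts I–II `|Z(G)| = 4`, `c = ⁅a, b⁆` for any non-commuting `a, b`, all squares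
  central; `Z(G)` cyclic ⟹ adjusting `a, b` by the centre gives a quaternion pair (part III §2); `Z(G) = {1, c, n, cn}` Klein ⟹ the SQUARE PATTERN
  `(a², b², (ab)² = c a² b²) ∈ Z(G)³` — the row `(c, c)` is a quaternion pair, each of the other fifteen rows yields dihedral quotient data
  `(n′, u, w)` (part III §1), i.e. seat b09 gen 46ʼs kernel-two law (the abstract rows `D₄ × ℤ/2` (`r²`), `ℤ/4 ⋊ ℤ/4` (`a²`), `G(16,3)` (`b`)).
§4: with seat b23 gen 50ʼs orders `2, 4, 8` — **every 2-group of order `≤ 16` and every central involution** (`…_of_card_two_pow_le_sixteen`).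
All [folklore].

## References
* [Pohlmann1968] H. Pohlmann, Algebraic cycles on abelian varieties of complex multiplication type, Ann. of Math. 88 (1968), Thm 1.
-/

namespace Summit.HodgeConjecture.CorCM.Census.OrderSixteen

open Subgroup
open scoped commutatorElement
open Summit.HodgeConjecture.CorCM.Prior.AllgGroup.RfwfAllgGroup
open Summit.HodgeConjecture.CorCM.Census.BlockParity
open Summit.HodgeConjecture.CorCM.Census.Coinvariant

noncomputable section

variable {G : Type*} [Group G] [Fintype G] [DecidableEq G] {c : G}

/-! ## §1 A second central involution -/

omit [DecidableEq G] in
/-- In a subgroup of order `4` containing `1 ≠ c` there is a third element. [folklore] -/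
theorem exists_mem_ne_of_card_four (H : Subgroup G) (h4 : Nat.card H = 4) (hc : c ∈ H) : ∃ n ∈ H, n ≠ 1 ∧ n ≠ c := by
  classical
  by_contra hall
  push Not at hall
  haveI : Fintype H := Fintype.ofFinite H
  have hsub : (Finset.univ : Finset H) ⊆ {⟨1, H.one_mem⟩, ⟨c, hc⟩} := by
    intro x _
    rw [Finset.mem_insert, Finset.mem_singleton]
    by_cases hx : (x : G) = 1
    · exact Or.inl (Subtype.ext hx)
    · exact Or.inr (Subtype.ext (hall x x.2 hx))
  have hle := Finset.card_le_card hsub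
  rw [Finset.card_univ, ← Nat.card_eq_fintype_card, h4] at hle
  have h2 : ({⟨1, H.one_mem⟩, ⟨c, hc⟩} : Finset H).card ≤ 2 := Finset.card_le_two
  omega

/-! ## §2 The residue: `c ∈ [G, G]`, no element of order `8` -/

/-- **THE RESIDUE OF THE ORDER-16 DISPATCH**: `|G| = 16`, no element of order `8`, `c ≠ 1` a central involution IN the commutator subgroup ⟹
**`μ(G, c) = φ₂(G, c)`** — a quaternion pair (cyclic centre, or square pattern `(c, c)`) or dihedral quotient data (the fifteen other square patterns).
[folklore] -/
theorem isLeast_of_mem_commutator (hG : Nat.card G = 16) (h8 : ∀ u : G, orderOf u ≠ 8) (hc2 : c * c = 1) (hc1 : c ≠ 1)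
    (hcen : ∀ x : G, x * c = c * x) (hc : c ∈ commutator G) :
    IsLeast {m : ℕ | ∃ S : Finset (CMF G c →₀ ℤ), (↑S ⊆ gfaceSet G c hc2) ∧ S.card = m ∧
      hodgeSpan c hc2 ≤ Submodule.span ℤ (pairSet c) ⊔ Submodule.span ℤ (translates c S)} (fibreTwo c hc2) := by
  -- a non-commuting pair; `a b = c · b a`
  obtain ⟨a, b, hab⟩ : ∃ a b : G, a * b ≠ b * a := by
    by_contra hall
    push Not at hall
    rw [commutator_eq_bot_of_forall_comm hall, Subgroup.mem_bot] at hc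
    exact hc1 hc
  have hrule : a * b = c * (b * a) := mul_eq_of_mem_commutator hG h8 hab hc hc1
  have hba : b * a = c * (a * b) := by rw [hrule, ← mul_assoc, hc2, one_mul]
  have h4 : ∀ g : G, g ^ 4 = 1 := QuaternionDoubling.pow_four_eq_one_of_no_eight hG h8
  have hsqc : ∀ x g : G, g * (x * x) = x * x * g := mul_self_comm hG h8
  have hp4 : ∀ x : G, x * x * (x * x) = 1 := fun x => by
    rw [show x * x * (x * x) = x ^ 4 by simp only [pow_succ, pow_zero, one_mul, mul_assoc], h4]
  -- the centre: order `4`, contains `c`, `a²`, `b²`, and a second involution `n`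
  have hZ4 : Nat.card (center G) = 4 := card_center_eq_four hG h8 hab
  have hcZ : c ∈ center G := mem_center_iff.mpr hcen
  have haaZ : a * a ∈ center G := mul_self_mem_center hG h8 a
  have hbbZ : b * b ∈ center G := mul_self_mem_center hG h8 b
  obtain ⟨n, hnZ, hn1, hnc⟩ := exists_mem_ne_of_card_four (center G) hZ4 hcZ
  have hncen : ∀ x : G, x * n = n * x := mem_center_iff.mp hnZ
  -- the five squares
  have hab2 : a * b * (a * b) = c * (a * a * (b * b)) := by
    calc a * b * (a * b) = a * (b * a) * b := by simp only [mul_assoc]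
      _ = a * (c * (a * b)) * b := by rw [hba]
      _ = (a * c) * (a * (b * b)) := by simp only [mul_assoc]
      _ = (c * a) * (a * (b * b)) := by rw [hcen a]
      _ = c * (a * a * (b * b)) := by simp only [mul_assoc]
  have hba2 : b * a * (b * a) = c * (a * a * (b * b)) := by
    rw [hba]
    calc c * (a * b) * (c * (a * b)) = c * ((a * b) * c) * (a * b) := by simp only [mul_assoc]
      _ = c * (c * (a * b)) * (a * b) := by rw [hcen]
      _ = (c * c) * (a * b * (a * b)) := by simp only [mul_assoc]
      _ = c * (a * a * (b * b)) := by rw [hc2, one_mul, hab2]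
  have haab : a * (a * b) * (a * (a * b)) = b * b := by
    calc a * (a * b) * (a * (a * b)) = a * a * (b * (a * a)) * b := by simp only [mul_assoc]
      _ = a * a * (a * a * b) * b := by rw [hsqc a b]
      _ = (a * a * (a * a)) * (b * b) := by simp only [mul_assoc]
      _ = b * b := by rw [hp4, one_mul]
  have habb : a * b * b * (a * b * b) = a * a := by
    calc a * b * b * (a * b * b) = a * (b * b * a) * (b * b) := by simp only [mul_assoc]
      _ = a * (a * (b * b)) * (b * b) := by rw [← hsqc b a]
      _ = (a * a) * (b * b * (b * b)) := by simp only [mul_assoc]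
      _ = a * a := by rw [hp4, mul_one]
  have hbab : b * (a * b) * (b * (a * b)) = a * a := by
    have e : b * (a * b) = c * (a * b * b) := by rw [← mul_assoc, hba, mul_assoc]
    rw [e]
    calc c * (a * b * b) * (c * (a * b * b)) = c * ((a * b * b) * c) * (a * b * b) := by simp only [mul_assoc]
      _ = c * (c * (a * b * b)) * (a * b * b) := by rw [hcen]
      _ = (c * c) * (a * b * b * (a * b * b)) := by simp only [mul_assoc]
      _ = a * a := by rw [hc2, one_mul, habb]
  -- the five non-commutations
  have h_b_a : b * a ≠ a * b := fun h => hab h.symm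
  have h_ab_a : a * b * a ≠ a * (a * b) := fun h => hab (by
    rw [mul_assoc] at h; exact (mul_left_cancel h).symm)
  have h_ab_b : a * b * b ≠ b * (a * b) := fun h => hab (by
    rw [← mul_assoc] at h; exact mul_right_cancel h)
  have h_b_ab : b * (a * b) ≠ a * b * b := fun h => h_ab_b h.symm
  by_cases hnn : n * n = 1
  · /- the Klein centre `{1, c, n, cn}`: the square pattern -/
    have hcncen : ∀ x : G, x * (c * n) = c * n * x := fun x => by rw [← mul_assoc, hcen x, mul_assoc, hncen x, ← mul_assoc]
    have hcncn : c * n * (c * n) = 1 := by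
      calc c * n * (c * n) = c * (n * c) * n := by simp only [mul_assoc]
        _ = c * (c * n) * n := by rw [hcen n]
        _ = (c * c) * (n * n) := by simp only [mul_assoc]
        _ = 1 := by rw [hc2, hnn, one_mul]
    have hcinv : c⁻¹ = c := inv_eq_of_mul_eq_one_right hc2
    have hcn1 : c * n ≠ 1 := fun h => hnc (by rw [← hcinv]; exact (eq_inv_of_mul_eq_one_right h))
    have hcnc : c * n ≠ c := fun h => hn1 (mul_left_cancel (a := c) (by rw [h, mul_one]))
    have hcnn : c * n ≠ n := fun h => hc1 (mul_right_cancel (b := n) (by rw [h, one_mul]))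
    have hZmem : ∀ {t : G}, t ∈ center G → t = 1 ∨ t = c ∨ t = n ∨ t = c * n := fun ht =>
      mem_four_of_card_four (center G) hZ4 hcZ hnZ hc1 hn1 hnc.symm hcn1 hcnc hcnn ht
    -- shorthand for the two bricks
    have D := fun {n' u w : G} => isLeast_of_dihedral_elements (c := c) (n := n') (u := u) (w := w) hG hc2 hc1 hcen
    rcases hZmem haaZ with ha | ha | ha | ha <;> rcases hZmem hbbZ with hb | hb | hb | hb
    · -- (1, 1): u = ab, w = a, n' = n
      exact D hncen hnn hn1 hnc h_ab_a (Or.inl (by rw [hab2, ha, hb, mul_one, mul_one])) (Or.inl ha) (Or.inl (by rw [haab, hb]))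
    · -- (1, c): u = b, w = a, n' = n
      exact D hncen hnn hn1 hnc h_b_a (Or.inl hb) (Or.inl ha) (Or.inl (by rw [hab2, ha, hb, one_mul, hc2]))
    · -- (1, n): u = ab, w = a, n' = n
      exact D hncen hnn hn1 hnc h_ab_a (Or.inr (by rw [hab2, ha, hb, one_mul])) (Or.inl ha) (Or.inr (by rw [haab, hb]))
    · -- (1, cn): u = ab, w = a, n' = cn
      exact D hcncen hcncn hcn1 hcnc h_ab_a (Or.inr (by rw [hab2, ha, hb, one_mul])) (Or.inl ha) (Or.inr (by rw [haab, hb]))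
    · -- (c, 1): u = a, w = b, n' = n
      exact D hncen hnn hn1 hnc hab (Or.inl ha) (Or.inl hb) (Or.inl (by rw [hba2, ha, hb, mul_one, hc2]))
    · -- (c, c): the quaternion pair `(a, b)`
      exact isLeast_of_quaternion_elements hG hc2 hc1 hcen ha hb hrule
    · -- (c, n): u = a, w = b, n' = n
      exact D hncen hnn hn1 hnc hab (Or.inl ha) (Or.inr hb) (Or.inr (by rw [hba2, ha, hb, ← mul_assoc, hc2, one_mul]))
    · -- (c, cn): u = a, w = b, n' = cn
      exact D hcncen hcncn hcn1 hcnc hab (Or.inl ha) (Or.inr hb) (Or.inr (by rw [hba2, ha, hb, ← mul_assoc, hc2, one_mul]))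
    · -- (n, 1): u = ab, w = b, n' = n
      exact D hncen hnn hn1 hnc h_ab_b (Or.inr (by rw [hab2, ha, hb, mul_one])) (Or.inl hb) (Or.inr (by rw [hbab, ha]))
    · -- (n, c): u = b, w = a, n' = n
      exact D hncen hnn hn1 hnc h_b_a (Or.inl hb) (Or.inr ha) (Or.inr (by rw [hab2, ha, hb, hcen n, ← mul_assoc, hc2, one_mul]))
    · -- (n, n): u = ab, w = a, n' = n
      exact D hncen hnn hn1 hnc h_ab_a (Or.inl (by rw [hab2, ha, hb, hnn, mul_one])) (Or.inr ha) (Or.inr (by rw [haab, hb]))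
    · -- (n, cn): u = b, w = ab, n' = n
      exact D hncen hnn hn1 hnc h_b_ab (Or.inr hb) (Or.inl (by rw [hab2, ha, hb, ← mul_assoc, hcncn])) (Or.inr (by rw [habb, ha]))
    · -- (cn, 1): u = ab, w = b, n' = cn
      exact D hcncen hcncn hcn1 hcnc h_ab_b (Or.inr (by rw [hab2, ha, hb, mul_one])) (Or.inl hb) (Or.inr (by rw [hbab, ha]))
    · -- (cn, c): u = b, w = a, n' = cn
      exact D hcncen hcncn hcn1 hcnc h_b_a (Or.inl hb) (Or.inr ha)
        (Or.inr (by rw [hab2, ha, hb, mul_assoc c n c, hcen n, ← mul_assoc c c, hc2, one_mul]))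
    · -- (cn, n): u = b, w = ab, n' = cn
      exact D hcncen hcncn hcn1 hcnc h_b_ab (Or.inr (by rw [hb, ← mul_assoc, hc2, one_mul]))
        (Or.inl (by rw [hab2, ha, hb, mul_assoc c n n, hnn, mul_one, hc2])) (Or.inr (by rw [habb, ha]))
    · -- (cn, cn): u = ab, w = a, n' = cn
      exact D hcncen hcncn hcn1 hcnc h_ab_a (Or.inl (by rw [hab2, ha, hb, hcncn, mul_one])) (Or.inr ha) (Or.inr (by rw [haab, hb]))
  · /- the cyclic centre `⟨n⟩`, `n² = c`: a quaternion pair -/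
    have hn2Z : n * n ∈ center G := mul_self_mem_center hG h8 n
    have hn3 : n * (n * n) ≠ 1 := fun h => hn1 (by
      have e : n ^ 4 = n * (n * (n * n)) := by simp only [pow_succ, pow_zero, one_mul, mul_assoc]
      rw [h4, h, mul_one] at e; exact e.symm)
    have hnn2 : n ≠ n * n := fun h => hn1 (mul_left_cancel (a := n) (by rw [mul_one]; exact h.symm))
    have hn3n : n * (n * n) ≠ n := fun h => hnn (mul_left_cancel (a := n) (by rw [mul_one]; exact h))
    have hn3n2 : n * (n * n) ≠ n * n := fun h => hn1 (mul_right_cancel (b := n * n) (by rw [one_mul]; exact h))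
    have hZmem : ∀ {t : G}, t ∈ center G → t = 1 ∨ t = n ∨ t = n * n ∨ t = n * (n * n) := fun ht =>
      mem_four_of_card_four (center G) hZ4 hnZ hn2Z hn1 hnn hnn2 hn3 hn3n hn3n2 ht
    have hn6 : n * (n * n) * (n * (n * n)) = n * n := by
      calc n * (n * n) * (n * (n * n)) = (n * n * (n * n)) * (n * n) := by simp only [mul_assoc]
        _ = n * n := by rw [hp4, one_mul]
    -- `c = n²`
    have hcnn : c = n * n := by
      rcases hZmem hcZ with h | h | h | h
      · exact absurd h hc1
      · exact absurd (by rw [← hc2, h]) hnn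
      · exact h
      · exfalso; apply hnn; rw [← hc2, h, hn6]
    -- squares of `a`, `b` lie in `{1, c}`
    have hsq : ∀ {x : G}, x * x ∈ center G → x * x = 1 ∨ x * x = c := fun {x} hx => by
      rcases hZmem hx with h | h | h | h
      · exact Or.inl h
      · exfalso; apply hnn; rw [← h, hp4]
      · exact Or.inr (by rw [h, hcnn])
      · exfalso; apply hnn; rw [← hn6, ← h, hp4]
    -- adjusting by `n`
    have hadj : ∀ {x : G}, x * x = 1 → x * n * (x * n) = c := fun {x} hx => by
      calc x * n * (x * n) = x * (n * x) * n := by simp only [mul_assoc]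
        _ = x * (x * n) * n := by rw [hncen x]
        _ = (x * x) * (n * n) := by simp only [mul_assoc]
        _ = c := by rw [hx, one_mul, hcnn]
    have hanb : a * n * b = c * (b * (a * n)) := by
      calc a * n * b = a * (n * b) := by rw [mul_assoc]
        _ = a * (b * n) := by rw [hncen b]
        _ = c * (b * a) * n := by rw [← mul_assoc, hrule]
        _ = c * (b * (a * n)) := by simp only [mul_assoc]
    have habn : a * (b * n) = c * (b * n * a) := by
      calc a * (b * n) = c * (b * a) * n := by rw [← mul_assoc, hrule]
        _ = c * (b * (a * n)) := by simp only [mul_assoc]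
        _ = c * (b * (n * a)) := by rw [hncen a]
        _ = c * (b * n * a) := by simp only [mul_assoc]
    have hanbn : a * n * (b * n) = c * (b * n * (a * n)) := by
      calc a * n * (b * n) = a * (n * b) * n := by simp only [mul_assoc]
        _ = a * (b * n) * n := by rw [hncen b]
        _ = c * (b * n * a) * n := by rw [habn]
        _ = c * (b * n * (a * n)) := by simp only [mul_assoc]
    rcases hsq haaZ with ha | ha <;> rcases hsq hbbZ with hb | hb
    · exact isLeast_of_quaternion_elements hG hc2 hc1 hcen (hadj ha) (hadj hb) hanbn
    · exact isLeast_of_quaternion_elements hG hc2 hc1 hcen (hadj ha) hb hanb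
    · exact isLeast_of_quaternion_elements hG hc2 hc1 hcen ha (hadj hb) habn
    · exact isLeast_of_quaternion_elements hG hc2 hc1 hcen ha hb hrule

/-! ## §3 The law -/

/-- **THE ORDER-16 DISPATCH — EVERY GROUP OF ORDER `16` AND EVERY CENTRAL INVOLUTION `c ≠ 1`: `μ(G, c) = φ₂(G, c)`**, classification-free:
an element of order `8` (seat b23 gen 50) ∨ `c ∉ [G, G]` (seat b09 gen 44) ∨ the residue (§2: quaternion pair or dihedral quotient data).
[folklore] -/
theorem isLeast_card_gfaces_generate_fibreTwo_of_card_eq_sixteen (c : G) (hG : Fintype.card G = 16) (hc2 : c * c = 1) (hc1 : c ≠ 1)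
    (hcen : ∀ w : G, w * c = c * w) :
    IsLeast {m : ℕ | ∃ S : Finset (CMF G c →₀ ℤ), (↑S ⊆ gfaceSet G c hc2) ∧ S.card = m ∧
      hodgeSpan c hc2 ≤ Submodule.span ℤ (pairSet c) ⊔ Submodule.span ℤ (translates c S)} (fibreTwo c hc2) := by
  have hG' : Nat.card G = 16 := by rw [Nat.card_eq_fintype_card, hG]
  by_cases h8 : ∃ u : G, orderOf u = 8
  · -- (A) a cyclic subgroup of index two
    obtain ⟨u, hu⟩ := h8
    have hindex : (zpowers u).index = 2 := by
      have h := (zpowers u).card_mul_index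
      rw [Nat.card_zpowers, hu, hG'] at h
      omega
    exact IndexTwoCyclic.isLeast_card_gfaces_generate_fibreTwo_of_two_group hc2 hc1 hcen u (k := 4) (by rw [hG]; norm_num) (by norm_num) hindex
  · push Not at h8
    by_cases hK : c ∈ commutator G
    · -- (R) the residue
      exact isLeast_of_mem_commutator hG' h8 hc2 hc1 hcen hK
    · -- (K) the commutator law
      exact CyclicCharacter.isLeast_card_gfaces_generate_fibreTwo_of_notMem_commutator hc2 hcen hK

/-- `Nat.card` form of the order-16 dispatch. [folklore] -/
theorem isLeast_card_gfaces_generate_fibreTwo_of_natCard_eq_sixteen (c : G) (hG : Nat.card G = 16) (hc2 : c * c = 1) (hc1 : c ≠ 1)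
    (hcen : ∀ w : G, w * c = c * w) :
    IsLeast {m : ℕ | ∃ S : Finset (CMF G c →₀ ℤ), (↑S ⊆ gfaceSet G c hc2) ∧ S.card = m ∧
      hodgeSpan c hc2 ≤ Submodule.span ℤ (pairSet c) ⊔ Submodule.span ℤ (translates c S)} (fibreTwo c hc2) :=
  isLeast_card_gfaces_generate_fibreTwo_of_card_eq_sixteen c (by rw [← Nat.card_eq_fintype_card, hG]) hc2 hc1 hcen

/-- **Uniqueness form**: under the same hypotheses every least generating number equals `φ₂(G, c)`. [folklore] -/
theorem eq_fibreTwo_of_isLeast_of_card_eq_sixteen (c : G) (hG : Fintype.card G = 16) (hc2 : c * c = 1) (hc1 : c ≠ 1)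
    (hcen : ∀ w : G, w * c = c * w) {μ : ℕ}
    (hμ : IsLeast {m : ℕ | ∃ S : Finset (CMF G c →₀ ℤ), (↑S ⊆ gfaceSet G c hc2) ∧ S.card = m ∧
      hodgeSpan c hc2 ≤ Submodule.span ℤ (pairSet c) ⊔ Submodule.span ℤ (translates c S)} μ) : μ = fibreTwo c hc2 :=
  hμ.unique (isLeast_card_gfaces_generate_fibreTwo_of_card_eq_sixteen c hG hc2 hc1 hcen)

/-! ## §4 Every 2-group of order `≤ 16` -/

/-- **EVERY 2-GROUP OF ORDER `≤ 16` AND EVERY CENTRAL INVOLUTION `c ≠ 1`: `μ(G, c) = φ₂(G, c)`** — orders `2, 4, 8` by seat b23 gen 50ʼs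
`IndexTwoCyclic.isLeast_card_gfaces_generate_fibreTwo_of_card_two_pow_le_eight`, order `16` by the dispatch. [folklore] -/
theorem isLeast_card_gfaces_generate_fibreTwo_of_card_two_pow_le_sixteen {G : Type} [Group G] [Fintype G] [DecidableEq G] (c : G) {k : ℕ}
    (hG : Fintype.card G = 2 ^ k) (hk : k ≤ 4) (hc2 : c * c = 1) (hc1 : c ≠ 1) (hcen : ∀ w : G, w * c = c * w) :
    IsLeast {m : ℕ | ∃ S : Finset (CMF G c →₀ ℤ), (↑S ⊆ gfaceSet G c hc2) ∧ S.card = m ∧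
      hodgeSpan c hc2 ≤ Submodule.span ℤ (pairSet c) ⊔ Submodule.span ℤ (translates c S)} (fibreTwo c hc2) := by
  by_cases h4 : k = 4
  · subst h4
    exact isLeast_card_gfaces_generate_fibreTwo_of_card_eq_sixteen c (by rw [hG]; norm_num) hc2 hc1 hcen
  · exact IndexTwoCyclic.isLeast_card_gfaces_generate_fibreTwo_of_card_two_pow_le_eight hc2 hc1 hcen hG (by omega)

end

end Summit.HodgeConjecture.CorCM.Census.OrderSixteen
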